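import Summits.SmoothPoincare4.SmoothPoincare4.Theses.InformationMetricHadamard
import Summits.SmoothPoincare4.SmoothPoincare4.Theorems.InformationMetricHadamardC0AhRecognitionStubNormSubLeEdist
import Mathlib.Topology.MetricSpace.HausdorffDistance

/-!
# Line `core-distance-morse`, crux `InformationMetricHadamard.C0AhRecognition` (stmt-SmoothPoincare4-6015) — stub E1, helpers 4 and 5: regular directions with margin (near and far field)

In the polar package (`d_G(p, Ex p u) = |u|_{G_p}` and the CAT(0) comparison
`|(Ex z)⁻¹ p − (Ex z)⁻¹ q|_{G_z} ≤ d_G(p, q)` of helper 1), write `V_p(z) = (Ex z)⁻¹ p`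
(`|V_p(z)|_{G_z} = d(z, p)`). Polarisation gives the comparison law of cosines
`G_z(V_p, V_q) ≥ (d(z,p)² + d(z,q)² − d(p,q)²)/2` (`val_symm_symm_ge`). Two consequences used by
the apex stub (Grove–Shiohama 1977, §1; Petersen 2016, §12.1):

* `helper_gradientLikeField_4` — NEAR FIELD: if nearest points on the compact `K` of every
  `y ∉ K` are `ρ · d(y, K)`-close (`ρ < √2`) and `2μ < 2 − ρ₊²`, then around every `z₀` with
  `d(z₀, K) > 0` and a nearest point `k₁`, there are an open `O ∋ z₀` and `η₀ > 0` such that for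
  `z ∈ O` and every `η₀`-almost nearest point `k` of `z`: `μ d(z,k₁) d(z,k) ≤ G_z(V_{k₁}, V_k)`
  (compactness of `K` + continuity; `z ≠ k₁` on `O`).
* `helper_gradientLikeField_5` — FAR FIELD: if `d(o, k) ≤ D` and `d(o, z) ≥ 2D` then
  `½ d(o,z) d(z,k) ≤ G_z(V_o, V_k)`.

Everything is proved (kind = proof); no definitions.
-/

noncomputable section

-- the prescribed namespace `Summit.<P>.<Sub>.…` duplicates `SmoothPoincare4` (P = Sub)
set_option linter.dupNamespace false

open scoped Manifold ContDiff Topology ENNReal NNReal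
open Set Function Bundle Filter

namespace Summit.SmoothPoincare4.SmoothPoincare4.Cruxes.C0AhRecognition.CoreDistanceMorse

open Literature.Geometry.Lorentzian (PseudoRiemannianMetric)

section LawOfCosines

variable {W : Type} [TopologicalSpace W] [T2Space W] [SecondCountableTopology W]
  [ChartedSpace (EuclideanSpace ℝ (Fin 5)) W] [IsManifold (𝓡 5) ∞ W]
  (G : PseudoRiemannianMetric (𝓡 5) ∞ (EuclideanSpace ℝ (Fin 5)) (TangentSpace (𝓡 5) : W → Type _))
  (hG : G.IsRiemannian) (Ex : W → (EuclideanSpace ℝ (Fin 5) ≃ₘ^∞⟮𝓡 5, 𝓡 5⟯ W))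
  (hpol : ∀ (p : W) (u : EuclideanSpace ℝ (Fin 5)),
    G.edist hG p (Ex p u) = ENNReal.ofReal (Real.sqrt (G.val p u u)))
  (hlip : ∀ (y p q : W), ENNReal.ofReal (Real.sqrt
      (G.val y ((Ex y).symm p - (Ex y).symm q) ((Ex y).symm p - (Ex y).symm q))) ≤
    G.edist hG p q)

omit [T2Space W] [SecondCountableTopology W] in
include hpol in
/-- In the polar package, `d_G(z, p) = |(Ex z)⁻¹ p|_{G_z}`: the real distance is the square root
of `G_z(V_p, V_p)`, `V_p = (Ex z)⁻¹ p`. [folklore] -/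
theorem toReal_edist_eq_sqrt_val_symm (z p : W) :
    (G.edist hG z p).toReal = Real.sqrt (G.val z ((Ex z).symm p) ((Ex z).symm p)) := by
  have h := hpol z ((Ex z).symm p)
  rw [(Ex z).apply_symm_apply] at h
  rw [h, ENNReal.toReal_ofReal (Real.sqrt_nonneg _)]

omit [T2Space W] [SecondCountableTopology W] in
include hpol in
/-- In the polar package all distances are finite. [folklore] -/
theorem edist_ne_top_of_polar (z p : W) : G.edist hG z p ≠ ⊤ := by
  have h := hpol z ((Ex z).symm p)
  rw [(Ex z).apply_symm_apply] at h
  rw [h]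
  exact ENNReal.ofReal_ne_top

omit [T2Space W] [SecondCountableTopology W] in
include hpol hlip in
/-- **Comparison law of cosines (CAT(0) form).** In the polar package with the `1`-Lipschitz
inverse, `G_z(V_p, V_q) ≥ (d(z,p)² + d(z,q)² − d(p,q)²)/2` for `V_p = (Ex z)⁻¹ p`,
`V_q = (Ex z)⁻¹ q` (polarisation of `|V_p − V_q|²_{G_z} ≤ d(p,q)²`).
[cite: BridsonHaefliger1999, Ch. II.1, Prop. 1.7 (4)] -/
theorem val_symm_symm_ge (z p q : W) :
    ((G.edist hG z p).toReal ^ 2 + (G.edist hG z q).toReal ^ 2 - (G.edist hG p q).toReal ^ 2) / 2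
      ≤ G.val z ((Ex z).symm p) ((Ex z).symm q) := by
  set B : EuclideanSpace ℝ (Fin 5) →L[ℝ] EuclideanSpace ℝ (Fin 5) →L[ℝ] ℝ := G.val z with hB
  have hBv : ∀ v w : EuclideanSpace ℝ (Fin 5), B v w = G.val z v w := fun _ _ ↦ rfl
  have hBs : ∀ v w : EuclideanSpace ℝ (Fin 5), B v w = B w v := fun v w ↦ G.symm z v w
  have hnn : ∀ v : EuclideanSpace ℝ (Fin 5), 0 ≤ B v v := fun v ↦ by
    by_cases hv : v = 0
    · subst hv; simp
    · exact (hG z v hv).le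
  set Vp : EuclideanSpace ℝ (Fin 5) := (Ex z).symm p
  set Vq : EuclideanSpace ℝ (Fin 5) := (Ex z).symm q
  -- the three squared lengths
  have hp2 : (G.edist hG z p).toReal ^ 2 = B Vp Vp := by
    rw [toReal_edist_eq_sqrt_val_symm G hG Ex hpol z p]
    exact Real.sq_sqrt (hnn Vp)
  have hq2 : (G.edist hG z q).toReal ^ 2 = B Vq Vq := by
    rw [toReal_edist_eq_sqrt_val_symm G hG Ex hpol z q]
    exact Real.sq_sqrt (hnn Vq)
  have hpq : B (Vp - Vq) (Vp - Vq) ≤ (G.edist hG p q).toReal ^ 2 := by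
    have h1 := hlip z p q
    have h2 : Real.sqrt (B (Vp - Vq) (Vp - Vq)) ≤ (G.edist hG p q).toReal :=
      (ENNReal.ofReal_le_iff_le_toReal (edist_ne_top_of_polar G hG Ex hpol p q)).1 h1
    have h3 := pow_le_pow_left₀ (Real.sqrt_nonneg _) h2 2
    rwa [Real.sq_sqrt (hnn _)] at h3
  -- polarisation
  have hpolar : B (Vp - Vq) (Vp - Vq) = B Vp Vp - 2 * B Vp Vq + B Vq Vq := by
    rw [B.map_sub₂, map_sub, map_sub, hBs Vq Vp]
    ring
  rw [← hBv, hp2, hq2]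
  linarith

end LawOfCosines

set_option maxHeartbeats 1600000 in
/-- **E1 helper 5 (far field: the radial direction is regular).** In the polar package with the
`1`-Lipschitz inverse: if `d(o, k) ≤ D` (`D ≥ 0`) and `d(o, z) ≥ 2D`, then
`½ d(o,z) d(z,k) ≤ G_z((Ex z)⁻¹ o, (Ex z)⁻¹ k)` (comparison law of cosines: with `r = d(o,z)`,
`d = d(z,k)`, `G_z(V_o, V_k) ≥ (r² + d² − D²)/2 ≥ r d/2`).
[cite: GroveShiohama1977, §1; Petersen2016, §12.1] -/
theorem helper_gradientLikeField_5 :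
    ∀ (W : Type) [TopologicalSpace W] [T2Space W] [SecondCountableTopology W]
    [ChartedSpace (EuclideanSpace ℝ (Fin 5)) W] [IsManifold (𝓡 5) ∞ W]
    (G : Literature.Geometry.Lorentzian.PseudoRiemannianMetric (𝓡 5) ∞ (EuclideanSpace ℝ (Fin 5))
      (TangentSpace (𝓡 5) : W → Type _)) (hG : G.IsRiemannian)
    (Ex : W → (EuclideanSpace ℝ (Fin 5) ≃ₘ^∞⟮𝓡 5, 𝓡 5⟯ W)),
    (∀ (p : W) (u : EuclideanSpace ℝ (Fin 5)),
      G.edist hG p (Ex p u) = ENNReal.ofReal (Real.sqrt (G.val p u u))) →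
    (∀ (y p q : W), ENNReal.ofReal (Real.sqrt
        (G.val y ((Ex y).symm p - (Ex y).symm q) ((Ex y).symm p - (Ex y).symm q))) ≤
      G.edist hG p q) →
    ∀ (o z k : W) (D : ℝ), 0 ≤ D → G.edist hG o k ≤ ENNReal.ofReal D →
      ENNReal.ofReal (2 * D) ≤ G.edist hG o z →
      1 / 2 * (G.edist hG o z).toReal * (G.edist hG z k).toReal ≤
        G.val z ((Ex z).symm o) ((Ex z).symm k) := by
  intro W _ _ _ _ _ G hG Ex hpol hlip o z k D hD hok hoz
  have hcos := val_symm_symm_ge G hG Ex hpol hlip z o k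
  have hfin := edist_ne_top_of_polar G hG Ex hpol
  set r : ℝ := (G.edist hG o z).toReal with hr
  set d : ℝ := (G.edist hG z k).toReal with hd
  have hzo : (G.edist hG z o).toReal = r := by rw [hr, G.edist_comm hG]
  have hr0 : 2 * D ≤ r := (ENNReal.ofReal_le_iff_le_toReal (hfin o z)).1 hoz
  have hd0 : 0 ≤ d := ENNReal.toReal_nonneg
  have hDk : (G.edist hG o k).toReal ≤ D := by
    have := ENNReal.toReal_mono ENNReal.ofReal_ne_top hok
    rwa [ENNReal.toReal_ofReal hD] at this
  have hDk0 : 0 ≤ (G.edist hG o k).toReal := ENNReal.toReal_nonneg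
  rw [hzo] at hcos
  have h1 : (G.edist hG o k).toReal ^ 2 ≤ D ^ 2 := pow_le_pow_left₀ hDk0 hDk 2
  nlinarith [hcos, h1, sq_nonneg (d - r / 2)]

set_option maxHeartbeats 1600000 in
/-- **E1 helper 4 (near field: the direction away from a nearest point is regular, with margin,
for all almost-nearest points, locally uniformly).** In the polar package with the `1`-Lipschitz
inverse, let `K` be compact with the `ρ`-spread property (nearest points of `y ∉ K` are
`ρ d(y,K)`-close) and let `0 < μ`, `2μ < 2 − (ρ₊)²`. If `d(z₀, K) > 0` and `k₁ ∈ K` is a nearest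
point of `z₀`, there are an open `O ∋ z₀` and `η₀ > 0` such that for all `z ∈ O`: `z ≠ k₁`, and
for every `k ∈ K` with `d(z,k) ≤ d(z,K) + η₀`, `μ d(z,k₁) d(z,k) ≤ G_z((Ex z)⁻¹ k₁, (Ex z)⁻¹ k)`
(at `z₀` and an exact nearest `k` the law of cosines and the spread give the margin
`d² (2 − ρ₊² − 2μ) > 0`; compactness of `K` and continuity propagate it).
[cite: GroveShiohama1977, §1; Petersen2016, §12.1 Prop. 12.1.2] -/
theorem helper_gradientLikeField_4 :
    ∀ (W : Type) [TopologicalSpace W] [T2Space W] [SecondCountableTopology W]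
    [ChartedSpace (EuclideanSpace ℝ (Fin 5)) W] [IsManifold (𝓡 5) ∞ W]
    (G : Literature.Geometry.Lorentzian.PseudoRiemannianMetric (𝓡 5) ∞ (EuclideanSpace ℝ (Fin 5))
      (TangentSpace (𝓡 5) : W → Type _)) (hG : G.IsRiemannian)
    (Ex : W → (EuclideanSpace ℝ (Fin 5) ≃ₘ^∞⟮𝓡 5, 𝓡 5⟯ W)),
    (∀ (p : W) (u : EuclideanSpace ℝ (Fin 5)),
      G.edist hG p (Ex p u) = ENNReal.ofReal (Real.sqrt (G.val p u u))) →
    (∀ (y p q : W), ENNReal.ofReal (Real.sqrt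
        (G.val y ((Ex y).symm p - (Ex y).symm q) ((Ex y).symm p - (Ex y).symm q))) ≤
      G.edist hG p q) →
    ∀ (K : Set W), IsCompact K → ∀ (ρ μ : ℝ), 0 < μ → 2 * μ < 2 - (max ρ 0) ^ 2 →
      (∀ y ∈ Kᶜ, ∀ k₁ ∈ K, ∀ k₂ ∈ K,
        G.edist hG y k₁ = ⨅ k ∈ K, G.edist hG y k → G.edist hG y k₂ = ⨅ k ∈ K, G.edist hG y k →
        G.edist hG k₁ k₂ ≤ ENNReal.ofReal ρ * ⨅ k ∈ K, G.edist hG y k) →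
      ∀ (z₀ k₁ : W), k₁ ∈ K → 0 < ⨅ k ∈ K, G.edist hG z₀ k →
        G.edist hG z₀ k₁ = ⨅ k ∈ K, G.edist hG z₀ k →
        ∃ O : Set W, IsOpen O ∧ z₀ ∈ O ∧ ∃ η₀ : ℝ, 0 < η₀ ∧ ∀ z ∈ O, z ≠ k₁ ∧
          ∀ k ∈ K, G.edist hG z k ≤ (⨅ k' ∈ K, G.edist hG z k') + ENNReal.ofReal η₀ →
            μ * (G.edist hG z k₁).toReal * (G.edist hG z k).toReal ≤
              G.val z ((Ex z).symm k₁) ((Ex z).symm k) := by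
  intro W _ _ _ _ _ G hG Ex hpol hlip K hK ρ μ hμ hμρ hspread z₀ k₁ hk₁ hf0 hnear
  have hcos := val_symm_symm_ge G hG Ex hpol hlip
  have hfinG := edist_ne_top_of_polar G hG Ex hpol
  -- the distance structure of `(W, G)`; `f = infEDist(·, K)`
  letI := G.riemannianBundle hG
  haveI := G.isContinuousRiemannianBundle hG
  haveI : LocallyCompactSpace W := ChartedSpace.locallyCompactSpace (EuclideanSpace ℝ (Fin 5)) W
  letI : PseudoEMetricSpace W := .ofRiemannianMetric (𝓡 5) W
  have hed : ∀ y z : W, G.edist hG y z = edist y z := fun _ _ ↦ rfl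
  set f : W → ℝ≥0∞ := fun y ↦ ⨅ k ∈ K, G.edist hG y k with hf
  have hfE : ∀ y : W, f y = Metric.infEDist y K := fun _ ↦ rfl
  have hfin : ∀ y z : W, edist y z ≠ ⊤ := fun y z ↦ hfinG y z
  have hffin : ∀ y : W, f y ≠ ⊤ := fun y ↦
    ne_top_of_le_ne_top (hfin y k₁) (by rw [hfE]; exact Metric.infEDist_le_edist_of_mem hk₁)
  have hfle : ∀ (y : W), ∀ k ∈ K, f y ≤ edist y k := fun y k hk ↦ by
    rw [hfE]; exact Metric.infEDist_le_edist_of_mem hk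
  -- real versions and their continuity
  set dR : W → W → ℝ := fun y z ↦ (edist y z).toReal with hdR
  set fR : W → ℝ := fun y ↦ (f y).toReal with hfR
  have hdRc : Continuous fun p : W × W ↦ dR p.1 p.2 :=
    ENNReal.continuousOn_toReal.comp_continuous continuous_edist fun p ↦ hfin p.1 p.2
  have hfc : Continuous f := by
    have : Continuous fun y : W ↦ Metric.infEDist y K := Metric.continuous_infEDist
    exact this
  have hfRc : Continuous fR := ENNReal.continuousOn_toReal.comp_continuous hfc fun y ↦ hffin y
  -- data at `z₀`
  set T : ℝ := fR z₀ with hT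
  have hT0 : 0 < T := ENNReal.toReal_pos hf0.ne' (hffin z₀)
  have hz₀K : z₀ ∈ Kᶜ := by
    intro hz
    have : f z₀ ≤ edist z₀ z₀ := hfle z₀ z₀ hz
    rw [edist_self, nonpos_iff_eq_zero] at this
    exact hf0.ne' this
  have hd1 : dR z₀ k₁ = T := by
    show (edist z₀ k₁).toReal = (f z₀).toReal
    rw [← hed, hnear]
  set ρp : ℝ := max ρ 0 with hρp
  have hρp0 : 0 ≤ ρp := le_max_right _ _
  -- the margin function `Θ` and the gap function `Λ = max Θ (d - f)`
  set Θ : W → W → ℝ := fun z k ↦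
    dR z k₁ ^ 2 + dR z k ^ 2 - dR k₁ k ^ 2 - 2 * μ * dR z k₁ * dR z k with hΘ
  set Λ : W → W → ℝ := fun z k ↦ max (Θ z k) (dR z k - fR z) with hΛ
  have hΛc : Continuous fun p : W × W ↦ Λ p.1 p.2 := by
    have h1 : Continuous fun p : W × W ↦ dR p.1 k₁ :=
      hdRc.comp (continuous_fst.prodMk continuous_const)
    have h2 : Continuous fun p : W × W ↦ dR k₁ p.2 :=
      hdRc.comp (continuous_const.prodMk continuous_snd)
    have h3 : Continuous fun p : W × W ↦ fR p.1 := hfRc.comp continuous_fst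
    exact ((((h1.pow 2).add (hdRc.pow 2)).sub (h2.pow 2)).sub
      (((continuous_const.mul h1).mul hdRc))).max (hdRc.sub h3)
  -- ### at `z₀`: `Λ(z₀, k) > 0` for every `k ∈ K`
  have hpos : ∀ k ∈ K, 0 < Λ z₀ k := by
    intro k hk
    have hge : fR z₀ ≤ dR z₀ k := ENNReal.toReal_mono (hfin _ _) (hfle z₀ k hk)
    rcases hge.lt_or_eq with hlt | heq
    · exact lt_max_of_lt_right (by linarith)
    · -- `k` is an exact nearest point: spread + law of cosines
      have hkn : G.edist hG z₀ k = ⨅ k' ∈ K, G.edist hG z₀ k' := by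
        show edist z₀ k = f z₀
        exact (ENNReal.toReal_eq_toReal_iff' (hfin _ _) (hffin _)).1 heq.symm
      have hsp := hspread z₀ hz₀K k₁ hk₁ k hk hnear hkn
      have hsp' : dR k₁ k ≤ ρp * T := by
        have h1 := ENNReal.toReal_mono (ENNReal.mul_ne_top ENNReal.ofReal_ne_top (hffin z₀)) hsp
        rw [ENNReal.toReal_mul, ENNReal.toReal_ofReal'] at h1
        exact h1
      have hdk : dR z₀ k = T := heq.symm
      have hΘ0 : 0 < Θ z₀ k := by
        show 0 < dR z₀ k₁ ^ 2 + dR z₀ k ^ 2 - dR k₁ k ^ 2 - 2 * μ * dR z₀ k₁ * dR z₀ k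
        rw [hd1, hdk]
        have h1 : dR k₁ k ^ 2 ≤ (ρp * T) ^ 2 := pow_le_pow_left₀ ENNReal.toReal_nonneg hsp' 2
        have h2 : 0 < T ^ 2 * (2 - ρp ^ 2 - 2 * μ) := mul_pos (pow_pos hT0 2) (by linarith)
        nlinarith [h1, h2]
      exact lt_max_of_lt_left hΘ0
  -- a uniform positive lower bound `m` on the compact `K`
  obtain ⟨kmin, hkminK, hkmin⟩ := hK.exists_isMinOn ⟨k₁, hk₁⟩
    ((hΛc.comp (continuous_const.prodMk continuous_id)).continuousOn :
      ContinuousOn (fun k : W ↦ Λ z₀ k) K)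
  set m : ℝ := Λ z₀ kmin with hm
  have hm0 : 0 < m := hpos kmin hkminK
  have hmle : ∀ k ∈ K, m ≤ Λ z₀ k := fun k hk ↦ hkmin hk
  -- ### propagate to a neighbourhood of `z₀`, uniformly in `k ∈ K`
  have hev : ∀ᶠ z in 𝓝 z₀, ∀ k ∈ K, m / 2 < Λ z k := by
    apply hK.eventually_forall_of_forall_eventually
    intro k hk
    have hca : ContinuousAt (fun p : W × W ↦ Λ p.1 p.2) (z₀, k) := hΛc.continuousAt
    exact hca.eventually (Ioi_mem_nhds (by linarith [hmle k hk]))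
  have hev2 : ∀ᶠ z in 𝓝 z₀, T / 2 < fR z :=
    hfRc.continuousAt.eventually (Ioi_mem_nhds (by linarith))
  obtain ⟨O, hO, hOo, hz₀O⟩ := eventually_nhds_iff.1 (hev.and hev2)
  refine ⟨O, hOo, hz₀O, m / 2, by linarith, fun z hz ↦ ⟨?_, fun k hk hkal ↦ ?_⟩⟩
  · -- `z ≠ k₁`
    intro hzk
    have h1 : T / 2 < fR z := (hO z hz).2
    have h2 : fR z ≤ dR z k₁ := ENNReal.toReal_mono (hfin _ _) (hfle z k₁ hk₁)
    have h3 : dR z k₁ = 0 := by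
      show (edist z k₁).toReal = 0
      rw [hzk, edist_self, ENNReal.toReal_zero]
    linarith
  · -- the margin at an almost-nearest point
    have h1 : m / 2 < Λ z k := (hO z hz).1 k hk
    have h2 : dR z k - fR z ≤ m / 2 := by
      have h3 := ENNReal.toReal_mono (ENNReal.add_ne_top.2 ⟨hffin z, ENNReal.ofReal_ne_top⟩) hkal
      rw [ENNReal.toReal_add (hffin z) ENNReal.ofReal_ne_top,
        ENNReal.toReal_ofReal (by linarith)] at h3
      change dR z k ≤ fR z + m / 2 at h3
      linarith
    have h3 : m / 2 < Θ z k := by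
      rcases le_or_gt (Θ z k) (dR z k - fR z) with hle | hgt
      · have : Λ z k = dR z k - fR z := max_eq_right hle
        linarith
      · have : Λ z k = Θ z k := max_eq_left hgt.le
        linarith
    have h4 : 0 < dR z k₁ ^ 2 + dR z k ^ 2 - dR k₁ k ^ 2 - 2 * μ * dR z k₁ * dR z k := by
      have : (0 : ℝ) < Θ z k := by linarith
      exact this
    have h5 := hcos z k₁ k
    change (dR z k₁ ^ 2 + dR z k ^ 2 - dR k₁ k ^ 2) / 2 ≤ _ at h5
    change μ * dR z k₁ * dR z k ≤ _
    linarith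

end Summit.SmoothPoincare4.SmoothPoincare4.Cruxes.C0AhRecognition.CoreDistanceMorse

end
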